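import Mathlib
import Summits.Ventures.DiscreteObjects.Mahler.SmythTheorem
import Summits.Ventures.DiscreteObjects.Mahler.MahlerMeasureCompXPow
import Summits.Ventures.DiscreteObjects.Mahler.Height1CellSymmetry
import Summits.Ventures.DiscreteObjects.Mahler.SubLehmerDegree56

/-!
# Smyth's theorem, isolation of `θ₀` — the integer side (venture `DiscreteObjects`, target L)

Cell `pub-namedobj`, seat `pub-namedobj-mahler` (gen 8). Framing: lottery ticket; floor = certified
bounds/negative ranges.

Second piece of the isolation part of [McKee–Smyth, Thm 12.1] (blueprint
`HOME/pub-namedobj-mahler-g8/SMYTH-ISOLATION-PLAN.md` §2(c)), the algebra of (12.27)–(12.30):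
with `P₀ = z³ - z² + 1` (minimal polynomial of `-θ₀⁻¹`), `Q₀ = z³ P₀(1/z) = 1 - z + z³`,
and the data `εP = P*(1 + aX^k) + bX^ℓ + X^{ℓ+1}R` of a nonreciprocal monic `P` (`a = ±1`, `ℓ > 2k`):

* `intMahlerMeasure_reverse_of_monic` — `M(P*) = M(P)` for monic `P`;
* `intMahlerMeasure_smythP0a` — `M(1 - X^{2k} + a X^{3k}) = θ₀` (`= M(P₀(aX^k))`);
* `X_pow_dvd_smythD` — `X^{2k+1}` divides `D := εP·Q₀(aX^k) - P*·P₀(aX^k)`;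
* `intMahlerMeasure_le_smythTheta_of_smythD_eq_zero` — if `D = 0` and `P` is irreducible then
  `M(P) ≤ θ₀` (so `M(P) = θ₀` by Smyth's inequality): `P ∣ P*·P₀(aX^k)`, `P ∤ P*`, so `P ∣ P₀(aX^k)`.

The analytic side (Lemmas 12.17–12.19 and the assembly) is not in this file.
-/

namespace Summit.Ventures.DiscreteObjects.Mahler

open Polynomial

/-- `M(1 - αX) = max(1, |α|)`. -/
theorem mahlerMeasure_one_sub_C_mul_X (α : ℂ) : ((1 : ℂ[X]) - C α * X).mahlerMeasure = max 1 ‖α‖ := by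
  by_cases hα : α = 0
  · rw [hα, map_zero, zero_mul, sub_zero]
    rw [show (1 : ℂ[X]) = C 1 from rfl, mahlerMeasure_const, norm_one, norm_zero, max_eq_left zero_le_one]
  · have hinv : C α * C α⁻¹ = (1 : ℂ[X]) := by rw [← map_mul, mul_inv_cancel₀ hα, map_one]
    have e : ((1 : ℂ[X]) - C α * X) = C (-α) * (X - C α⁻¹) := by
      have : C (-α) * (X - C α⁻¹) = -(C α * X) + C α * C α⁻¹ := by rw [map_neg]; ring
      rw [this, hinv]; ring
    rw [e, mahlerMeasure_mul, mahlerMeasure_const, mahlerMeasure_X_sub_C, norm_neg, norm_inv]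
    have hpos : 0 < ‖α‖ := norm_pos_iff.mpr hα
    rcases le_or_gt ‖α‖ 1 with h | h
    · rw [max_eq_right (one_le_inv_iff₀.mpr ⟨hpos, h⟩), max_eq_left h, mul_inv_cancel₀ hpos.ne']
    · rw [max_eq_left (inv_le_one_of_one_le₀ h.le), mul_one, max_eq_right h.le]

/-- **`M(P*) = M(P)`** for a monic integer polynomial `P` (`P* = X^{deg P} P(1/X)`). -/
theorem intMahlerMeasure_reverse_of_monic {P : ℤ[X]} (hmonic : P.Monic) :
    intMahlerMeasure P.reverse = intMahlerMeasure P := by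
  unfold intMahlerMeasure
  set PC := P.map (Int.castRingHom ℂ) with hPC
  have hPCm : PC.Monic := hmonic.map _
  have hcard : Multiset.card PC.roots = PC.natDegree := ((IsAlgClosed.splits PC).natDegree_eq_card_roots).symm
  have hprod : (PC.roots.map fun a => X - C a).prod = PC := prod_multiset_X_sub_C_of_monic_of_roots_card_eq hPCm hcard
  rw [← reverse_map_intCast, ← hPC]
  conv_lhs => rw [← hprod, reverse_multiset_prod_X_sub_C]
  rw [prod_mahlerMeasure_eq_mahlerMeasure_prod, Multiset.map_map, mahlerMeasure_eq_leadingCoeff_mul_prod_roots,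
    hPCm.leadingCoeff, norm_one, one_mul]
  congr 1
  refine Multiset.map_congr rfl fun α _ => ?_
  simp only [Function.comp_apply]
  exact mahlerMeasure_one_sub_C_mul_X α

/-- `M(z³ - z² + 1) = θ₀` (`z³ - z² + 1 = (z³ - z + 1)* = ((-z)³ - (-z) - 1)*` up to sign). -/
theorem intMahlerMeasure_X_cube_sub_X_sq_add_one : intMahlerMeasure (X ^ 3 - X ^ 2 + 1 : ℤ[X]) = smythTheta := by
  have hmon : (X ^ 3 - X + 1 : ℤ[X]).Monic := by monicity!
  have hrev : (X ^ 3 - X + 1 : ℤ[X]).reverse = X ^ 3 - X ^ 2 + 1 := by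
    have hdeg : (X ^ 3 - X + 1 : ℤ[X]).natDegree = 3 := by compute_degree!
    unfold reverse
    rw [hdeg]
    ext n
    rw [coeff_reflect]
    rcases Nat.lt_or_ge n 4 with hn | hn
    · interval_cases n <;> simp [coeff_X, coeff_one, coeff_X_pow, revAt_le]
    · rw [revAt, Function.Embedding.coeFn_mk]
      simp only [show ¬ n ≤ 3 by omega, if_false]
      rw [coeff_eq_zero_of_natDegree_lt (by rw [hdeg]; omega)]
      have h2 : (X ^ 3 - X ^ 2 + 1 : ℤ[X]).natDegree = 3 := by compute_degree!
      rw [coeff_eq_zero_of_natDegree_lt (by rw [h2]; omega)]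
  have hneg : (X ^ 3 - X + 1 : ℤ[X]) = -((X ^ 3 - X - 1 : ℤ[X]).comp (-X)) := by
    simp only [sub_comp, pow_comp, X_comp, one_comp]; ring
  rw [← hrev, intMahlerMeasure_reverse_of_monic hmon, hneg, intMahlerMeasure_neg, intMahlerMeasure_comp_neg_X,
    intMahlerMeasure_X_cube_sub_X_sub_one]

/-- **`M(P₀(aX^k)) = θ₀`**: for `a = ±1`, `k ≥ 1`, `M(1 - X^{2k} + a X^{3k}) = θ₀`. -/
theorem intMahlerMeasure_smythP0a {a : ℤ} (ha : a = 1 ∨ a = -1) {k : ℕ} (hk : 1 ≤ k) :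
    intMahlerMeasure (1 - X ^ (2 * k) + C a * X ^ (3 * k) : ℤ[X]) = smythTheta := by
  rcases ha with h | h <;> subst h
  · have e : (1 - X ^ (2 * k) + C (1 : ℤ) * X ^ (3 * k) : ℤ[X]) = (X ^ 3 - X ^ 2 + 1 : ℤ[X]).comp (X ^ k) := by
      simp only [sub_comp, add_comp, pow_comp, X_comp, one_comp, map_one]; ring
    rw [e, intMahlerMeasure_comp_X_pow _ hk, intMahlerMeasure_X_cube_sub_X_sq_add_one]
  · have e : (1 - X ^ (2 * k) + C (-1 : ℤ) * X ^ (3 * k) : ℤ[X]) =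
        (((X ^ 3 - X ^ 2 + 1 : ℤ[X]).comp (-X)).comp (X ^ k)) := by
      simp only [sub_comp, add_comp, pow_comp, X_comp, one_comp, neg_comp, map_neg, map_one]; ring
    rw [e, intMahlerMeasure_comp_X_pow _ hk, intMahlerMeasure_comp_neg_X, intMahlerMeasure_X_cube_sub_X_sq_add_one]

/-- **(12.27): the discrepancy polynomial is `O(X^{2k+1})`.**  If `εP = P*(1 + aX^k) + bX^ℓ + X^{ℓ+1}R`
with `a² = 1` and `ℓ ≥ 2k + 1`, then `X^{2k+1}` divides
`D = εP·(1 - aX^k + aX^{3k}) - P*·(1 - X^{2k} + aX^{3k})`. -/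
theorem X_pow_dvd_smythD {P R : ℤ[X]} {ε a b : ℤ} {k ℓ : ℕ} (hk : 1 ≤ k) (hl : 2 * k + 1 ≤ ℓ)
    (haa : a * a = 1)
    (hid : C ε * P = P.reverse * (1 + C a * X ^ k) + C b * X ^ ℓ + X ^ (ℓ + 1) * R) :
    X ^ (2 * k + 1) ∣ C ε * P * (1 - C a * X ^ k + C a * X ^ (3 * k)) -
      P.reverse * (1 - X ^ (2 * k) + C a * X ^ (3 * k)) := by
  obtain ⟨k', rfl⟩ : ∃ k', k = k' + 1 := ⟨k - 1, by omega⟩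
  obtain ⟨m, rfl⟩ : ∃ m, ℓ = 2 * (k' + 1) + 1 + m := ⟨ℓ - (2 * (k' + 1) + 1), by omega⟩
  have hCa : C a * C a = (1 : ℤ[X]) := by rw [← map_mul, haa, map_one]
  refine ⟨P.reverse * X ^ (2 * k' + 1) + X ^ m * (C b + X * R) * (1 - C a * X ^ (k' + 1) + C a * X ^ (3 * (k' + 1))), ?_⟩
  rw [hid]
  have e1 : (1 + C a * X ^ (k' + 1)) * (1 - C a * X ^ (k' + 1) + C a * X ^ (3 * (k' + 1))) -
      (1 - X ^ (2 * (k' + 1)) + C a * X ^ (3 * (k' + 1))) = X ^ (4 * (k' + 1)) := by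
    have : (1 + C a * X ^ (k' + 1)) * (1 - C a * X ^ (k' + 1) + C a * X ^ (3 * (k' + 1))) -
        (1 - X ^ (2 * (k' + 1)) + C a * X ^ (3 * (k' + 1))) =
        (1 - C a * C a) * X ^ (2 * (k' + 1)) + C a * C a * X ^ (4 * (k' + 1)) := by ring
    rw [this, hCa]; ring
  linear_combination P.reverse * e1

/-- If `P ∣ P*` for a monic `P` with `P(0) = ε = ±1`, then `P* = ε P`. -/
theorem reverse_eq_of_dvd {P : ℤ[X]} (hmonic : P.Monic) {ε : ℤ} (hε : P.coeff 0 = ε) (hε1 : ε * ε = 1)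
    (hdvd : P ∣ P.reverse) : P.reverse = C ε * P := by
  obtain ⟨q, hq⟩ := hdvd
  have hε0 : ε ≠ 0 := by rintro rfl; simp at hε1
  have hP0 : P ≠ 0 := hmonic.ne_zero
  have hrevdeg : P.reverse.natDegree = P.natDegree := by
    rw [reverse_natDegree, natTrailingDegree_eq_zero_of_constantCoeff_ne_zero, Nat.sub_zero]
    rw [constantCoeff_apply, hε]; exact hε0
  have hrev0 : P.reverse ≠ 0 := by
    intro h; rw [h, natDegree_zero] at hrevdeg
    -- degree 0 monic ⇒ P = 1, then reverse 1 = 1 ≠ 0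
    have hP1 : P = 1 := hmonic.natDegree_eq_zero.mp hrevdeg.symm
    rw [hP1] at h; simp at h
  have hq0 : q ≠ 0 := by rintro rfl; rw [mul_zero] at hq; exact hrev0 hq
  have hqdeg : q.natDegree = 0 := by
    have h := congrArg natDegree hq
    rw [natDegree_mul hP0 hq0, hrevdeg] at h
    omega
  obtain ⟨c, hc⟩ := natDegree_eq_zero.mp hqdeg
  rw [← hc] at hq
  -- leading coefficients: `lc(P*) = P(0) = ε`, `lc(P · C c) = c`
  have hlc : P.reverse.leadingCoeff = c := by
    rw [hq, leadingCoeff_mul, leadingCoeff_C, hmonic.leadingCoeff, one_mul]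
  rw [reverse_leadingCoeff, trailingCoeff, natTrailingDegree_eq_zero_of_constantCoeff_ne_zero, hε] at hlc
  · rw [hq, ← hlc, mul_comm]
  · rw [constantCoeff_apply, hε]; exact hε0

/-- **The degenerate alternative `D = 0` forces `M(P) ≤ θ₀`.**  If `P` is monic irreducible with
`P(0) = ε = ±1`, `P* ≠ εP`, and `εP·Q₀(aX^k) = P*·P₀(aX^k)` (`a = ±1`, `k ≥ 1`), then `P ∣ P₀(aX^k)` and
`M(P) ≤ M(P₀(aX^k)) = θ₀`. -/
theorem intMahlerMeasure_le_smythTheta_of_smythD_eq_zero {P : ℤ[X]} (hmonic : P.Monic) (hirr : Irreducible P)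
    {ε : ℤ} (hε : P.coeff 0 = ε) (hε1 : ε * ε = 1) (hne : P.reverse ≠ C ε * P)
    {a : ℤ} (ha : a = 1 ∨ a = -1) {k : ℕ} (hk : 1 ≤ k)
    (hD : C ε * P * (1 - C a * X ^ k + C a * X ^ (3 * k)) = P.reverse * (1 - X ^ (2 * k) + C a * X ^ (3 * k))) :
    intMahlerMeasure P ≤ smythTheta := by
  have hprime : Prime P := hirr.prime
  have hdvd : P ∣ P.reverse * (1 - X ^ (2 * k) + C a * X ^ (3 * k)) := by
    rw [← hD]; exact Dvd.intro (C ε * (1 - C a * X ^ k + C a * X ^ (3 * k))) (by ring)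
  rcases hprime.dvd_or_dvd hdvd with h | h
  · exact absurd (reverse_eq_of_dvd hmonic hε hε1 h) hne
  · obtain ⟨q, hq⟩ := h
    have hq0 : q ≠ 0 := by
      intro h0
      rw [h0, mul_zero] at hq
      have := congrArg (fun p : ℤ[X] => p.coeff 0) hq
      have hk0 : k ≠ 0 := by omega
      simp [hk0] at this
    have hM := intMahlerMeasure_smythP0a ha hk
    rw [hq, intMahlerMeasure_mul] at hM
    have h1 : 1 ≤ intMahlerMeasure q := one_le_intMahlerMeasure hq0
    have h0 : 0 ≤ intMahlerMeasure P := by unfold intMahlerMeasure; exact mahlerMeasure_nonneg _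
    nlinarith

end Summit.Ventures.DiscreteObjects.Mahler
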